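import Literature.Probability.Percolation.RSWProofs
import Literature.Probability.Percolation.PlanarDuality
import Literature.Probability.Percolation.CrossingChains
import Literature.Probability.Percolation.AnnulusCircuitsProofs
import Literature.Probability.Percolation.FourArmGarbanDocking
import HarnessLib

/-!
# Crux `StripClusterRates` (stmt-CriticalPhenomena-13878), line two-cluster-rate-is-stationary-gap, reshape 5 (lead c6):
registered stub `stub_cgGlueMinus`

Support file (`--supports stmt-CriticalPhenomena-13878`). See the skeleton
`Cruxes/StripClusterRates/Lines/two_cluster_rate_is_stationary_gap.lean`, section `ConfinedGluing`, for the role of this stub in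
the confined-gluing order transfer (γ₂-half of the crux from Cardy-order two-cluster Kac).

Content: the deterministic gluing of the DECREASING parts of two end-confined blocks. Everything
is a statement about the dual configuration `ω' = dualConfig ω`, which is itself a lattice
configuration (`ω' ⊆ E(ℤ²)`, faces indexed by lower-left corners), so the gluing is the usual
box-crossing gluing of open paths (Bollobás–Riordan 2006, Ch. 3, proof of eq. (2); Grimmett 1999,
§11.2 and proof of Lemma 11.75): the confined dual crossing `δ₁` of block 1 ends with a
left-right crossing of the face box `F₁ = [M₁-b, M₁] × [b+1, 2b]`, the dual crossing `H` of the
glue face box `[M₁-b, M₁+2b+2] × [b+1, 2b]` starts with one, and both meet the dual top-bottom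
crossing of `F₁`; symmetrically at the face box `F₂ = [M₁+b+1, M₁+2b+2] × [b+1, 2b]` with the
(translated) confined dual crossing `δ₂` of block 2.  All five regions lie in the confined
middle region of the long block `[0, M₁+b+2+M₂]`.

References: B. Bollobás, O. Riordan, *Percolation* (2006), Ch. 3; G. Grimmett, *Percolation*
(1999), §11.2, §11.7.
-/

noncomputable section

open MeasureTheory Filter Topology Set
open Literature.Probability.LatticeModels Literature.Probability.Percolation

namespace Summit.CriticalPhenomena.CardyFormulaZ2.Cruxes.StripClusterRates.TwoClusterRateIsStationaryGap

/-! ### Two local tools -/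

/-- **Recentring a translated crossing event** (the tree's recipe `relabel_mem_openCrossing` +
`relabel_shift_neg_relabel_shift`): if `ω - v ∈ C(S; A, B)` then `ω ∈ C(S + v; A + v, B + v)`.
[folklore] -/
theorem mem_openCrossing_image_of_relabel_shift_neg {v : Site 2} {ω : BondConfig (Site 2)}
    {S A B : Set (Site 2)}
    (h : BondConfig.relabel (sym2Equiv (Site.shift (-v))) ω ∈ openCrossing S A B) :
    ω ∈ openCrossing ((· + v) '' S) ((· + v) '' A) ((· + v) '' B) := by
  have h' := relabel_mem_openCrossing (Site.shift v) h
  have e := relabel_shift_neg_relabel_shift (-v) ω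
  rw [neg_neg] at e
  rw [e] at h'
  exact h'

/-- **Two left-right crossings and one top-bottom crossing of a box are joined inside the box.**
On a lattice configuration, if the translated rectangle `F = u + [0, m] × [0, n]` has an open
top-bottom crossing and two open paths inside `F` from its left column to its right column,
`p₁ ↝ p₂` and `q₁ ↝ q₂`, then `p₂` and `q₁` are joined by an open path inside `F`: both
horizontal paths meet the vertical one (Bollobás–Riordan 2006, Ch. 3, proof of eq. (2), "this
path must meet" the horizontal crossings; the tree's `exists_mem_support_of_crossing`).
[folklore] -/
theorem openConnIn_of_lr_tb_lr {ω : BondConfig (Site 2)} (hω : ω ⊆ (zdGraph 2).edgeSet)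
    {u p₁ p₂ q₁ q₂ : Site 2} {m n : ℕ}
    (hV : ω ∈ openCrossing ((· + u) '' (rectangle m n : Set (Site 2)))
      ((· + u) '' (bottomSide m n : Set (Site 2))) ((· + u) '' (topSide m n : Set (Site 2))))
    (hP : ω ∈ openConnIn ((· + u) '' (rectangle m n : Set (Site 2))) p₁ p₂)
    (hp₁ : p₁ 0 = u 0) (hp₂ : p₂ 0 = u 0 + m)
    (hQ : ω ∈ openConnIn ((· + u) '' (rectangle m n : Set (Site 2))) q₁ q₂)
    (hq₁ : q₁ 0 = u 0) (hq₂ : q₂ 0 = u 0 + m) :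
    ω ∈ openConnIn ((· + u) '' (rectangle m n : Set (Site 2))) p₂ q₁ := by
  classical
  set F : Set (Site 2) := (· + u) '' (rectangle m n : Set (Site 2)) with hF
  obtain ⟨c, d, T, hc, hd, hT, hTω⟩ := exists_walk_of_mem_tbCrossingAt hω hV
  obtain ⟨P, hPS, hPω⟩ := exists_walk_of_mem_openConnIn hω hP
  obtain ⟨Q, hQS, hQω⟩ := exists_walk_of_mem_openConnIn hω hQ
  have hTS : ∀ z ∈ T.support, z ∈ F := fun z hz => mem_image_rectangle_iff.2 (hT z hz)
  obtain ⟨w, hwP, hwT⟩ := exists_mem_support_of_crossing P T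
    (fun z hz => mem_image_rectangle_iff.1 (hPS z hz)) hT hp₁ hp₂ hc hd
  obtain ⟨w', hw'Q, hw'T⟩ := exists_mem_support_of_crossing Q T
    (fun z hz => mem_image_rectangle_iff.1 (hQS z hz)) hT hq₁ hq₂ hc hd
  -- `p₂ ↔ p₁ ↔ w` along `P`, `w ↔ c ↔ w'` along `T`, `w' ↔ q₁` along `Q`
  have c₁ : ω ∈ openConnIn F p₂ w :=
    PlanarDuality.openConnIn_trans (by rw [openConnIn_comm]; exact hP)
      (mem_openConnIn_of_mem_support P hPS hPω hwP)
  have c₂ : ω ∈ openConnIn F w w' :=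
    PlanarDuality.openConnIn_trans
      (by rw [openConnIn_comm]; exact mem_openConnIn_of_mem_support T hTS hTω hwT)
      (mem_openConnIn_of_mem_support T hTS hTω hw'T)
  have c₃ : ω ∈ openConnIn F w' q₁ := by
    rw [openConnIn_comm]; exact mem_openConnIn_of_mem_support Q hQS hQω hw'Q
  exact PlanarDuality.openConnIn_trans (PlanarDuality.openConnIn_trans c₁ c₂) c₃

/-! ### The stub -/

/-- **CG2⁻ · deterministic gluing of the decreasing parts of two end-confined blocks** (registered stub `stub_cgGlueMinus` of crux `StripClusterRates`, reshape 5): the dual-open confined face crossings of the two blocks and three dual-open crossings of the middle glue face box `[M₁-b, M₁+2b+2]×[b+1,2b]` give the dual-open confined face crossing of the long block. [folklore; cite: BollobasRiordan2006, Ch. 3, proof of eq. (2); GrimmettPercolation1999, §11.2] -/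
theorem stub_cgGlueMinus :
    ∀ (M₁ M₂ b : ℕ), 1 ≤ b → b + 1 ≤ M₁ → b + 1 ≤ M₂ → ∀ ω : BondConfig (Site 2), ω ⊆ (zdGraph 2).edgeSet → ω ∈ (dualConfig ⁻¹' openCrossing {z ∈ ((· + pt (-1) 0) '' (rectangle (M₁ + 1) (3 * b + 1) : Set (Site 2))) | (z 0 ≤ (b : ℤ) ∨ (M₁ : ℤ) ≤ z 0 + b) → (b : ℤ) + 1 ≤ z 1 ∧ z 1 ≤ 2 * (b : ℤ)} ((· + pt (-1) 0) '' (leftSide (M₁ + 1) (3 * b + 1) : Set (Site 2))) ((· + pt (-1) 0) '' (rightSide (M₁ + 1) (3 * b + 1) : Set (Site 2)))) → ω ∈ (BondConfig.relabel (sym2Equiv (Site.shift (-pt ((M₁ : ℤ) + b + 2) 0)))) ⁻¹' (dualConfig ⁻¹' openCrossing {z ∈ ((· + pt (-1) 0) '' (rectangle (M₂ + 1) (3 * b + 1) : Set (Site 2))) | (z 0 ≤ (b : ℤ) ∨ (M₂ : ℤ) ≤ z 0 + b) → (b : ℤ) + 1 ≤ z 1 ∧ z 1 ≤ 2 * (b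 : ℤ)} ((· + pt (-1) 0) '' (leftSide (M₂ + 1) (3 * b + 1) : Set (Site 2))) ((· + pt (-1) 0) '' (rightSide (M₂ + 1) (3 * b + 1) : Set (Site 2)))) → ω ∈ (dualConfig ⁻¹' (lrCrossingAt (pt ((M₁ : ℤ) - b) ((b : ℤ) + 1)) (3 * b + 2) (b - 1) ∩ (BondConfig.relabel (sym2Equiv (Site.shift (-pt ((M₁ : ℤ) - b) ((b : ℤ) + 1))))) ⁻¹' tbCrossing b (b - 1) ∩ (BondConfig.relabel (sym2Equiv (Site.shift (-pt ((M₁ : ℤ) + b + 1) ((b : ℤ) + 1))))) ⁻¹' tbCrossing (b + 1) (b - 1))) → ω ∈ (dualConfig ⁻¹' openCrossing {z ∈ ((· + pt (-1) 0) '' (rectangle ((M₁ + b + 2 + M₂ : ℕ) + 1) (3 * b + 1) : Set (Site 2))) | (z 0 ≤ (b : ℤ) ∨ ((M₁ + b + 2 + M₂ : ℕ) : ℤ) ≤ z 0 + b) → (b : ℤ) + 1 ≤ z 1 ∧ z 1 ≤ 2 * (b : ℤ)} ((· + pt (-1) 0) '' (leftSide ((M₁ + b + 2 + M₂ : ℕ)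 + 1) (3 * b + 1) : Set (Site 2))) ((· + pt (-1) 0) '' (rightSide ((M₁ + b + 2 + M₂ : ℕ) + 1) (3 * b + 1) : Set (Site 2)))) := by
  intro M₁ M₂ b hb hM₁ hM₂ ω _ h₁ h₂ h₃
  classical
  rw [Set.mem_preimage] at h₁ ⊢
  rw [Set.mem_preimage, Set.mem_preimage, dualConfig_relabel_shift] at h₂
  replace h₂ := mem_openCrossing_image_of_relabel_shift_neg h₂
  rw [Set.mem_preimage, Set.mem_inter_iff, Set.mem_inter_iff, Set.mem_preimage,
    Set.mem_preimage, tbCrossing, tbCrossing] at h₃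
  obtain ⟨⟨hH, hV₁⟩, hV₂⟩ := h₃
  replace hV₁ := mem_openCrossing_image_of_relabel_shift_neg hV₁
  replace hV₂ := mem_openCrossing_image_of_relabel_shift_neg hV₂
  have hω' : dualConfig ω ⊆ (zdGraph 2).edgeSet := fun _ he => (mem_dualConfig_iff.1 he).1
  set ω' := dualConfig ω with hω'def
  -- the confined dual crossing `δ₁ : x ↝ y` of block 1 and its tail after the last visit of the
  -- face column `M₁ - b` (a left-right crossing `z ↝ y` of `F₁`)
  obtain ⟨x, hx, y, hy, hxy⟩ := h₁
  rw [mem_image_add_leftSide] at hx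
  rw [mem_image_add_rightSide] at hy
  simp only [Matrix.cons_val_zero, Matrix.cons_val_one] at hx hy
  obtain ⟨z, hz0, hyz⟩ := exists_openConnIn_column_ge hω' ((M₁ : ℤ) - b) (x := y) (y := x)
    (by omega) (by omega) (by rw [openConnIn_comm]; exact hxy)
  have hP₁ : ω' ∈ openConnIn ((· + pt ((M₁ : ℤ) - b) ((b : ℤ) + 1)) '' (rectangle b (b - 1) : Set (Site 2))) z y := by
    rw [openConnIn_comm]
    refine openConnIn_mono ?_ _ _ hyz
    intro w hw
    simp only [Set.mem_inter_iff, Set.mem_setOf_eq, mem_image_rectangle_iff, Matrix.cons_val_zero,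
      Matrix.cons_val_one] at hw ⊢
    omega
  -- the dual crossing `H : xh ↝ yh` of the glue face box, its head up to the first visit of
  -- the face column `M₁` (inside `F₁`) and its tail after the last visit of `M₁ + b + 1` (in `F₂`)
  obtain ⟨xh, hxh, yh, hyh, hH'⟩ := hH
  rw [mem_image_add_leftSide] at hxh
  rw [mem_image_add_rightSide] at hyh
  simp only [Matrix.cons_val_zero, Matrix.cons_val_one] at hxh hyh
  obtain ⟨zh, hzh0, hxzh⟩ := exists_openConnIn_column hω' (M₁ : ℤ) (by omega) (by omega) hH'
  have hQ₁ : ω' ∈ openConnIn ((· + pt ((M₁ : ℤ) - b) ((b : ℤ) + 1)) '' (rectangle b (b - 1) : Set (Site 2))) xh zh := by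
    refine openConnIn_mono ?_ _ _ hxzh
    intro w hw
    simp only [Set.mem_inter_iff, Set.mem_setOf_eq, mem_image_rectangle_iff, Matrix.cons_val_zero,
      Matrix.cons_val_one] at hw ⊢
    omega
  obtain ⟨zh', hzh'0, hyzh'⟩ := exists_openConnIn_column_ge hω' ((M₁ : ℤ) + b + 1) (x := yh) (y := xh)
    (by omega) (by omega) (by rw [openConnIn_comm]; exact hH')
  have hP₂ : ω' ∈ openConnIn ((· + pt ((M₁ : ℤ) + b + 1) ((b : ℤ) + 1)) '' (rectangle (b + 1) (b - 1) : Set (Site 2))) zh' yh := by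
    rw [openConnIn_comm]
    refine openConnIn_mono ?_ _ _ hyzh'
    intro w hw
    simp only [Set.mem_inter_iff, Set.mem_setOf_eq, mem_image_rectangle_iff, Matrix.cons_val_zero,
      Matrix.cons_val_one] at hw ⊢
    omega
  -- the translated confined dual crossing `δ₂ : x₂ ↝ y₂` of block 2 and its head up to the first
  -- visit of the face column `M₁ + 2b + 2` (a left-right crossing of `F₂`)
  obtain ⟨x₂, hx₂, y₂, hy₂, hxy₂⟩ := h₂
  have hx₂' : x₂ 0 = (M₁ : ℤ) + b + 1 ∧ 0 ≤ x₂ 1 ∧ x₂ 1 ≤ 3 * (b : ℤ) + 1 := by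
    obtain ⟨a, ha, rfl⟩ := hx₂
    rw [mem_image_add_leftSide] at ha
    simp only [Pi.add_apply, Matrix.cons_val_zero, Matrix.cons_val_one] at ha ⊢
    omega
  have hy₂' : y₂ 0 = (M₁ : ℤ) + b + 2 + M₂ ∧ 0 ≤ y₂ 1 ∧ y₂ 1 ≤ 3 * (b : ℤ) + 1 := by
    obtain ⟨a, ha, rfl⟩ := hy₂
    rw [mem_image_add_rightSide] at ha
    simp only [Pi.add_apply, Matrix.cons_val_zero, Matrix.cons_val_one] at ha ⊢
    omega
  obtain ⟨z₂, hz₂0, hxz₂⟩ := exists_openConnIn_column hω' ((M₁ : ℤ) + 2 * b + 2) (by omega) (by omega) hxy₂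
  have hQ₂ : ω' ∈ openConnIn ((· + pt ((M₁ : ℤ) + b + 1) ((b : ℤ) + 1)) '' (rectangle (b + 1) (b - 1) : Set (Site 2))) x₂ z₂ := by
    refine openConnIn_mono ?_ _ _ hxz₂
    rintro w ⟨⟨a, ha, rfl⟩, hw⟩
    simp only [Set.mem_setOf_eq, mem_image_rectangle_iff, Pi.add_apply, Matrix.cons_val_zero,
      Matrix.cons_val_one] at ha hw ⊢
    omega
  -- the two junctions
  have J₁ := openConnIn_of_lr_tb_lr hω' hV₁ hP₁ (by simp only [Matrix.cons_val_zero]; omega)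
    (by simp only [Matrix.cons_val_zero]; omega) hQ₁ (by simp only [Matrix.cons_val_zero]; omega)
    (by simp only [Matrix.cons_val_zero]; omega)
  have J₂ := openConnIn_of_lr_tb_lr hω' hV₂ hP₂ (by simp only [Matrix.cons_val_zero]; omega)
    (by simp only [Matrix.cons_val_zero]; push_cast; omega) hQ₂ (by simp only [Matrix.cons_val_zero]; omega)
    (by simp only [Matrix.cons_val_zero]; push_cast; omega)
  -- assemble `x ↝ y ↝ xh ↝ yh ↝ x₂ ↝ y₂` inside the confined middle region of the long block
  refine ⟨x, ?_, y₂, ?_, ?_⟩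
  · rw [mem_image_add_leftSide]
    simp only [Matrix.cons_val_zero, Matrix.cons_val_one]
    omega
  · rw [mem_image_add_rightSide]
    simp only [Matrix.cons_val_zero, Matrix.cons_val_one]
    omega
  refine PlanarDuality.openConnIn_trans (PlanarDuality.openConnIn_trans (PlanarDuality.openConnIn_trans
    (PlanarDuality.openConnIn_trans (openConnIn_mono ?_ _ _ hxy) (openConnIn_mono ?_ _ _ J₁))
    (openConnIn_mono ?_ _ _ hH')) (openConnIn_mono ?_ _ _ J₂)) (openConnIn_mono ?_ _ _ hxy₂)
  · -- block 1's confined middle region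
    intro w hw
    simp only [Set.mem_setOf_eq, mem_image_rectangle_iff, Matrix.cons_val_zero,
      Matrix.cons_val_one] at hw ⊢
    omega
  · -- `F₁`
    intro w hw
    simp only [Set.mem_setOf_eq, mem_image_rectangle_iff, Matrix.cons_val_zero,
      Matrix.cons_val_one] at hw ⊢
    omega
  · -- the glue face box
    intro w hw
    simp only [Set.mem_setOf_eq, mem_image_rectangle_iff, Matrix.cons_val_zero,
      Matrix.cons_val_one] at hw ⊢
    omega
  · -- `F₂`
    intro w hw
    simp only [Set.mem_setOf_eq, mem_image_rectangle_iff, Matrix.cons_val_zero,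
      Matrix.cons_val_one] at hw ⊢
    omega
  · -- block 2's confined middle region, translated
    rintro w ⟨a, ha, rfl⟩
    simp only [Set.mem_setOf_eq, mem_image_rectangle_iff, Pi.add_apply, Matrix.cons_val_zero,
      Matrix.cons_val_one] at ha ⊢
    omega

end Summit.CriticalPhenomena.CardyFormulaZ2.Cruxes.StripClusterRates.TwoClusterRateIsStationaryGap

end
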